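import Literature.MathematicalPhysics.QuantumFieldTheory.ConformalBootstrap3D.PointKernelK34v2Data
import Literature.MathematicalPhysics.QuantumFieldTheory.ConformalBootstrap3D.PointKernelParts

/-!
# K34v2 certificate, kernel part file P65: one-cell head segments 171, 172, 173 in level ranges

The head cells whose kernel evaluation exceeds one `decide` are one-cell segments of `hsegsK34v2`; each is
checked by `PCert.hPartSideOK` (side conditions) and `PCert.hPartOK` per level range `[n_lo, n_lo + count)`
against an integer claim, the claims summing to `≥ 0` (`PointKernel.partsOK`); soundness is
`PCert.hParts_sound` (`PointKernelParts`).  The part files `P1, P2, …` are mutually independent (each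
imports only the data file); the ranges of one cell may span several of them, and the per-cell
conclusions `hparts_i` / `hcell_i` of those cells are assembled in `PointKernelK34v2.lean`.
Estimated kernel time 258 s.
-/

set_option maxRecDepth 100000
set_option maxHeartbeats 0

namespace Literature.MathematicalPhysics.QuantumFieldTheory.ConformalBootstrap3D.PointKernelK34v2

open Literature.MathematicalPhysics.QuantumFieldTheory.ConformalBootstrap3D.PointKernel

/-- levels `[31, 44)` of segment 171: partial lower sum `≥` claim. [folklore] -/
theorem part_171_1 : certK34v2.hPartOK (PCert.segAt hsegsK34v2 171) JHK34v2 31 13 (18054919097642721836106215434364934925) = true := by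
  decide +kernel

/-- levels `[44, 49)` of segment 171: partial lower sum `≥` claim. [folklore] -/
theorem part_171_2 : certK34v2.hPartOK (PCert.segAt hsegsK34v2 171) JHK34v2 44 5 (2631568364816342220390808665681610005) = true := by
  decide +kernel

/-- one-cell segment 172 (row 6, cell `[901/128, 1803/256]`, chord, `n_F = 48`,
3 level ranges): side conditions. [folklore] -/
theorem pside_172 : certK34v2.hPartSideOK (PCert.segAt hsegsK34v2 172) JHK34v2 = true := by
  decide +kernel

/-- its level ranges `(n_lo, count, claim)`. [folklore] -/
def parts_172 : List (ℕ × ℕ × ℤ) := [(0, 31, -20001522100504662917663770944323147356), (31, 13, 17731898732743839036297560389884332942), (44, 5, 2269623367760823881366210554438814416)]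

/-- the ranges tile `[0, n_F]` and the claims sum to `≥ 0`. [folklore] -/
theorem pcov_172 : PointKernel.partsOK 48 parts_172 = true := by
  decide +kernel

/-- levels `[0, 31)` of segment 172: partial lower sum `≥` claim. [folklore] -/
theorem part_172_0 : certK34v2.hPartOK (PCert.segAt hsegsK34v2 172) JHK34v2 0 31 (-20001522100504662917663770944323147356) = true := by
  decide +kernel

/-- levels `[31, 44)` of segment 172: partial lower sum `≥` claim. [folklore] -/
theorem part_172_1 : certK34v2.hPartOK (PCert.segAt hsegsK34v2 172) JHK34v2 31 13 (17731898732743839036297560389884332942) = true := by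
  decide +kernel

/-- levels `[44, 49)` of segment 172: partial lower sum `≥` claim. [folklore] -/
theorem part_172_2 : certK34v2.hPartOK (PCert.segAt hsegsK34v2 172) JHK34v2 44 5 (2269623367760823881366210554438814416) = true := by
  decide +kernel

/-- one-cell segment 173 (row 6, cell `[1803/256, 451/64]`, chord, `n_F = 48`,
3 level ranges): side conditions. [folklore] -/
theorem pside_173 : certK34v2.hPartSideOK (PCert.segAt hsegsK34v2 173) JHK34v2 = true := by
  decide +kernel

/-- its level ranges `(n_lo, count, claim)`. [folklore] -/
def parts_173 : List (ℕ × ℕ × ℤ) := [(0, 31, -19316389969809294976143348734182609642), (31, 13, 17408830902533862283179240924774903865), (44, 5, 1907559067275432692964107809407705779)]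

/-- the ranges tile `[0, n_F]` and the claims sum to `≥ 0`. [folklore] -/
theorem pcov_173 : PointKernel.partsOK 48 parts_173 = true := by
  decide +kernel

end Literature.MathematicalPhysics.QuantumFieldTheory.ConformalBootstrap3D.PointKernelK34v2
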